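import Mathlib
import Literature.NumberTheory.LFunctions.Zhang2022.Section2SmoothWeight
import Literature.NumberTheory.LFunctions.Zhang2022.Section4GaussianWeight
import HarnessLib

/-!
# Zhang (2022) §§15–17 (and §7, §14): the kernel of "integrating term by term" — the inverse
# Mellin transform of the smooth weight `ω` on vertical lines, and the term-by-term theorem

Topic `Literature/NumberTheory/LFunctions/Zhang2022` (Landau–Siegel audit tree; verdict-neutral).
Y. Zhang, *Discrete mean estimates and the Landau–Siegel zero*, arXiv:2211.02515v1 (2022)
[Zhang2022LandauSiegel] — **an unrefereed manuscript under adjudication** (cell siegel-zhang,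
D-0069 width campaign; DAG node ids `Z22:…` of `plan/DAG.tsv`). This file proves, UNCONDITIONALLY
(no Assumption (A), no named fact), the identity every "integrating term by term" step of §§15–17
rests on, and the term-by-term theorem itself:

* `Z22:§15.u010` [Z22 p. 80, tex L4041], in the proof of (15.4):
  "`(1/2πi)∫_{(−1/2)} ω(s)ds/(n^s(Dm)^{1−s}) = (1/Dm)(Dm/n)^{s₀} exp{−𝓛₂² log²(Dm/n)}`";
  the same kernel is "replacing the segment `𝔍(1)` by the line `σ = 3/2` and integrating term by
  term" before (17.3) [Z22 p. 96, tex L4719–4727] (`Z22:§17.u005`) and "in a way similar to the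
  proof of (17.3)" at (17.8) [Z22 p. 98, tex L4806]. THE IDENTITY (`SmoothWeight.integral_cpow_mul_omega`):
  for `𝓛₂ > 0`, real `t₀`, ANY real abscissa `c` and `y > 0`,
  `(1/2π) ∫_ℝ y^{c+it} ω(c+it) dt = y^{s₀} exp{−𝓛₂² log² y}`,
  `ω(s) = (√π/𝓛₂)exp{(s−s₀)²/(4𝓛₂²)}` (2.15), `s₀ = 1/2 + 2πit₀` — a completed-square Gaussian
  integral (Mathlib `integral_cexp_quadratic`); `integral_omega_div_cpow_mul_cpow` is the display
  of `Z22:§15.u010` verbatim (`M = Dm`, the factor `(Dm)^{−1}`); `integral_lineKer` the same in the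
  `𝔍(z)`-parametrisation `s = z + s₀ + iv` of §7 p. 13.
* **The term-by-term theorem** (`SmoothWeight.integral_LSeries_mul_sum_mul_omega`): for a Dirichlet
  series `A(s) = Σ_m a(m)m^{−s}` absolutely convergent on the line `σ = z + 1/2`, a Dirichlet
  polynomial `Σ_{n∈S} b(n)n^{s−1}` (`0 ∉ S`) and the weight `ω`,
  `(1/2π)∫_ℝ A(s)(Σ_n b(n)n^{s−1})ω(s) dv = Σ_m Σ_n a(m)m^{−s₀} b(n)n^{s₀−1} exp{−𝓛₂² log²(n/m)}`
  (`= Σ_mΣ_n a(m)b(n)n⁻¹(n/m)^{s₀}exp{−𝓛₂² log²(n/m)}`), the interchange justified by absolute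
  convergence against the Gaussian majorant of `|ω|` ((7.4), `norm_omega_segment_eq`).

The companion `Zhang2022/SmoothWeightSegmentTail.lean` bounds the difference between the line and
the segment `𝔍(z)` ("with a negligible error"), and `Zhang2022/PrimitiveCharOrthogonality.lean`
proves the character sum `Σ*_{ψ (mod p)} ψ(m)ψ̄(n)` of `Z22:§15.u011` / §17 p. 96.
Consumers (campaign): the §15 block (15.4) (`Z22:§15.u009–u012`, chain `Ded1524`), the §17 steps
(17.3)/(17.8) (chain `Ded1710`), the §16 analogue, §14 p. 77 and §7 `Z22:§7.u022`. Nothing here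
bears on Theorems 1–2 of the source or on the cell's verdict; typed ≠ discharged elsewhere.

## References

* Y. Zhang, arXiv:2211.02515v1 (2022), §2 (2.15); §7 p. 13 (`𝔍(α)`), (7.4); §15 p. 80 (proof of
  (15.4)); §17 p. 96 (before (17.3)), p. 98 ((17.8)). [cite: Zhang2022LandauSiegel, §15 (15.4); §17 (17.3), (17.8)]
-/

noncomputable section

open Complex Real Set MeasureTheory

namespace Literature.NumberTheory.LFunctions.Zhang2022

namespace SmoothWeight

/-! ## The inverse Mellin transform of `ω` on a vertical line -/

/-- **The `ω`-kernel of "integrating term by term"** (`Z22:§15.u010` [Z22 p. 80, tex L4041];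
`Z22:§17.u005` [p. 96, tex L4723]): for `𝓛₂ > 0`, real `t₀`, any real abscissa `c` and `y > 0`,
`(1/2π) ∫_ℝ y^{c+it} ω(c+it) dt = y^{s₀} exp{−𝓛₂² (log y)²}`, i.e.
`(1/2πi)∫_{(c)} y^s ω(s) ds = y^{s₀}e^{−𝓛₂² log² y}` (independent of `c`).
Proof: `y^{c+it}ω(c+it) = (√π/𝓛₂)exp{bt² + c₁t + d}` with `b = −1/(4𝓛₂²)`, and Mathlib's
`∫ exp{bt²+c₁t+d} = (π/−b)^{1/2}exp{d − c₁²/(4b)}`; the exponent collapses to `s₀ log y − 𝓛₂² log² y`.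
[cite: Zhang2022LandauSiegel, §15 p. 80 (proof of (15.4)); §17 p. 96] -/
theorem integral_cpow_mul_omega {L₂ : ℝ} (hL : 0 < L₂) (t₀ c : ℝ) {y : ℝ} (hy : 0 < y) :
    (1 / (2 * π) : ℂ) * ∫ t : ℝ, (y : ℂ) ^ ((c : ℂ) + t * I) * omega L₂ t₀ (c + t * I)
      = (y : ℂ) ^ (s0 t₀) * cexp (-(L₂ : ℂ) ^ 2 * (Real.log y : ℂ) ^ 2) := by
  set ℓ : ℝ := Real.log y with hℓ
  have hy0 : (y : ℂ) ≠ 0 := ofReal_ne_zero.mpr hy.ne'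
  have hL0 : (L₂ : ℂ) ≠ 0 := ofReal_ne_zero.mpr hL.ne'
  have hlog : Complex.log (y : ℂ) = (ℓ : ℂ) := (Complex.ofReal_log hy.le).symm
  have hcpow : ∀ s : ℂ, (y : ℂ) ^ s = cexp ((ℓ : ℂ) * s) := fun s => by
    rw [Complex.cpow_def_of_ne_zero hy0, hlog]
  -- the quadratic exponent
  set a : ℝ := c - 1 / 2 with ha
  set τ : ℝ := 2 * π * t₀ with hτ
  set b : ℂ := -(1 / (4 * (L₂ : ℂ) ^ 2)) with hb_def
  set c₁ : ℂ := (ℓ : ℂ) * I + ((τ : ℂ) + (a : ℂ) * I) / (2 * (L₂ : ℂ) ^ 2) with hc₁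
  set d : ℂ := (ℓ : ℂ) * c + ((a : ℂ) ^ 2 - 2 * (a : ℂ) * τ * I - (τ : ℂ) ^ 2) / (4 * (L₂ : ℂ) ^ 2)
    with hd
  have hb : b.re < 0 := by
    have : b = ((-(1 / (4 * L₂ ^ 2)) : ℝ) : ℂ) := by rw [hb_def]; push_cast; ring
    rw [this, ofReal_re]
    have : 0 < 1 / (4 * L₂ ^ 2) := by positivity
    linarith
  have h1 : ∀ t : ℝ, (y : ℂ) ^ ((c : ℂ) + t * I) * omega L₂ t₀ (c + t * I)
      = ((Real.sqrt π / L₂ : ℝ) : ℂ) * cexp (b * t ^ 2 + c₁ * t + d) := by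
    intro t
    rw [hcpow, omega_def, mul_left_comm, ← Complex.exp_add]
    congr 2
    rw [s0_def, hb_def, hc₁, hd, ha, hτ]
    push_cast
    field_simp
    ring_nf
    rw [I_sq]
    ring
  simp_rw [h1]
  rw [integral_const_mul, integral_cexp_quadratic hb]
  -- the constant `(π/−b)^{1/2} = 2𝓛₂√π`
  have h2 : ((π : ℂ) / -b) ^ (1 / 2 : ℂ) = ((2 * L₂ * Real.sqrt π : ℝ) : ℂ) := by
    have e1 : ((π : ℂ) / -b) = ((4 * π * L₂ ^ 2 : ℝ) : ℂ) := by
      rw [hb_def, neg_neg]; push_cast; field_simp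
    rw [e1, show (1 / 2 : ℂ) = ((1 / 2 : ℝ) : ℂ) by push_cast; ring, ← ofReal_cpow (by positivity),
      ← Real.sqrt_eq_rpow]
    congr 1
    rw [show 4 * π * L₂ ^ 2 = (2 * L₂) ^ 2 * π by ring, Real.sqrt_mul (by positivity),
      Real.sqrt_sq (by positivity)]
  -- the exponent `d − c₁²/(4b) = s₀ log y − 𝓛₂² log² y`
  have h3 : d - c₁ ^ 2 / (4 * b) = (ℓ : ℂ) * s0 t₀ + (-(L₂ : ℂ) ^ 2 * (ℓ : ℂ) ^ 2) := by
    rw [hd, hc₁, hb_def, s0_def, ha, hτ]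
    push_cast
    field_simp
    ring_nf
    rw [I_sq]
    ring
  rw [h2, h3, Complex.exp_add, ← hcpow]
  have hπ : (π : ℂ) ≠ 0 := ofReal_ne_zero.mpr Real.pi_ne_zero
  have hsq : ((Real.sqrt π : ℝ) : ℂ) ^ 2 = (π : ℂ) := by
    rw [← ofReal_pow, Real.sq_sqrt Real.pi_pos.le]
  push_cast
  field_simp
  rw [hsq]

/-- The display of `Z22:§15.u010` verbatim [Z22 p. 80, tex L4041]: for `𝓛₂ > 0`, real `t₀`, any
real `c`, and reals `n, M > 0` (`M` = the printed `Dm`),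
`(1/2π)∫_ℝ ω(c+it) n^{−(c+it)} M^{(c+it)−1} dt = M⁻¹ (M/n)^{s₀} exp{−𝓛₂² log²(M/n)}`.
[cite: Zhang2022LandauSiegel, §15 p. 80 (proof of (15.4))] -/
theorem integral_omega_div_cpow_mul_cpow {L₂ : ℝ} (hL : 0 < L₂) (t₀ c : ℝ) {n M : ℝ}
    (hn : 0 < n) (hM : 0 < M) :
    (1 / (2 * π) : ℂ) * ∫ t : ℝ, omega L₂ t₀ (c + t * I) * (n : ℂ) ^ (-((c : ℂ) + t * I)) *
        (M : ℂ) ^ (((c : ℂ) + t * I) - 1)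
      = (M : ℂ)⁻¹ * (((M / n : ℝ) : ℂ) ^ (s0 t₀) *
          cexp (-(L₂ : ℂ) ^ 2 * (Real.log (M / n) : ℂ) ^ 2)) := by
  have hn0 : (n : ℂ) ≠ 0 := ofReal_ne_zero.mpr hn.ne'
  have hM0 : (M : ℂ) ≠ 0 := ofReal_ne_zero.mpr hM.ne'
  have hMn : 0 < M / n := div_pos hM hn
  have hMn0 : ((M / n : ℝ) : ℂ) ≠ 0 := ofReal_ne_zero.mpr hMn.ne'
  have elog : ∀ {x : ℝ}, 0 < x → ∀ w : ℂ, (x : ℂ) ^ w = cexp ((Real.log x : ℂ) * w) :=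
    fun {x} hx w => by
      rw [Complex.cpow_def_of_ne_zero (ofReal_ne_zero.mpr hx.ne'), ← Complex.ofReal_log hx.le]
  have einv : (M : ℂ)⁻¹ = cexp (-(Real.log M : ℂ)) := by
    rw [Complex.exp_neg, ← Complex.ofReal_exp, Real.exp_log hM]
  have hlogdiv : (Real.log (M / n) : ℂ) = (Real.log M : ℂ) - (Real.log n : ℂ) := by
    rw [Real.log_div hM.ne' hn.ne']; push_cast; ring
  have key : ∀ t : ℝ, omega L₂ t₀ (c + t * I) * (n : ℂ) ^ (-((c : ℂ) + t * I)) *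
      (M : ℂ) ^ (((c : ℂ) + t * I) - 1)
        = (M : ℂ)⁻¹ * (((M / n : ℝ) : ℂ) ^ ((c : ℂ) + t * I) * omega L₂ t₀ (c + t * I)) := by
    intro t
    rw [elog hn, elog hM, elog hMn, einv, hlogdiv, mul_assoc, ← Complex.exp_add, ← mul_assoc,
      ← Complex.exp_add, mul_comm]
    congr 2
    ring
  simp_rw [key]
  rw [integral_const_mul, ← mul_assoc, mul_comm (1 / (2 * π) : ℂ), mul_assoc,
    integral_cpow_mul_omega hL t₀ c hMn]

/-! ## "Integrating term by term": a Dirichlet series against a Dirichlet polynomial and `ω`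
on the line through `𝔍(z)`

The line kernel in the `𝔍`-parametrisation `s = z + s₀ + iv` (§7 p. 13: `𝔍(z)` is the segment
`|v| ≤ 𝓛₁` of this line) is `K_y(v) = y^{z+s₀+iv} ω(z+s₀+iv)`, written out in full below. -/

/-- `z + s₀ + iv = (z + 1/2) + i(2πt₀ + v)`. [cite: Zhang2022LandauSiegel, §2 (2.15)] -/
theorem linePoint_eq (t₀ z v : ℝ) :
    (z : ℂ) + s0 t₀ + v * I = ((z + 1 / 2 : ℝ) : ℂ) + ((2 * π * t₀ + v : ℝ) : ℂ) * I := by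
  rw [s0_def]; push_cast; ring

/-- `Re(z + s₀ + iv) = z + 1/2`. [cite: Zhang2022LandauSiegel, §2 (2.15)] -/
theorem linePoint_re (t₀ z v : ℝ) : ((z : ℂ) + s0 t₀ + v * I).re = z + 1 / 2 := by
  rw [linePoint_eq]; simp

/-- **(7.4)'s Gaussian profile, factored**: on the line through `𝔍(z)`,
`|ω(z+s₀+iv)| = (√π/𝓛₂)e^{(z²−v²)/(4𝓛₂²)} = (√π/𝓛₂)e^{z²/(4𝓛₂²)}·e^{−v²/(4𝓛₂²)}`
(cf. `norm_omega_segment_eq`). [cite: Zhang2022LandauSiegel, §7 (7.4)] -/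
theorem profile_eq (L₂ z v : ℝ) :
    Real.sqrt π / L₂ * Real.exp ((z ^ 2 - v ^ 2) / (4 * L₂ ^ 2))
      = (Real.sqrt π / L₂ * Real.exp (z ^ 2 / (4 * L₂ ^ 2))) *
          Real.exp (-(1 / (4 * L₂ ^ 2)) * v ^ 2) := by
  rw [mul_assoc, ← Real.exp_add]; congr 2; ring

/-- **(7.4): "`∫_{𝔍} |ω(s)ds| ≪ 1`" — the profile `|ω(z+s₀+iv)|` is integrable over the whole line**
(a scaled Gaussian). [cite: Zhang2022LandauSiegel, §7 (7.4)] -/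
theorem integrable_profile {L₂ : ℝ} (hL : 0 < L₂) (z : ℝ) :
    Integrable fun v : ℝ => Real.sqrt π / L₂ * Real.exp ((z ^ 2 - v ^ 2) / (4 * L₂ ^ 2)) := by
  simp_rw [profile_eq]
  exact (integrable_exp_neg_mul_sq (by positivity)).const_mul _

/-- `|K_y(v)| = y^{z+1/2} (√π/𝓛₂)e^{(z²−v²)/(4𝓛₂²)}` for `y > 0`. [folklore] -/
private theorem norm_lineKer {L₂ : ℝ} (hL : 0 < L₂) (t₀ z : ℝ) {y : ℝ} (hy : 0 < y) (v : ℝ) :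
    ‖(y : ℂ) ^ ((z : ℂ) + s0 t₀ + v * I) * omega L₂ t₀ ((z : ℂ) + s0 t₀ + v * I)‖
      = y ^ (z + 1 / 2) * (Real.sqrt π / L₂ * Real.exp ((z ^ 2 - v ^ 2) / (4 * L₂ ^ 2))) := by
  rw [norm_mul, Complex.norm_cpow_eq_rpow_re_of_pos hy, linePoint_re, norm_omega_segment_eq hL]

/-- `v ↦ K_y(v)` is continuous (`y > 0`). [folklore] -/
private theorem continuous_lineKer (L₂ t₀ z : ℝ) {y : ℝ} (hy : 0 < y) :
    Continuous fun v : ℝ => (y : ℂ) ^ ((z : ℂ) + s0 t₀ + v * I) * omega L₂ t₀ ((z : ℂ) + s0 t₀ + v * I) := by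
  unfold omega
  have h1 : Continuous fun v : ℝ => (y : ℂ) ^ ((z : ℂ) + s0 t₀ + v * I) :=
    Continuous.const_cpow (by fun_prop) (Or.inl (ofReal_ne_zero.mpr hy.ne'))
  exact h1.mul (by fun_prop)

/-- `v ↦ K_y(v)` is absolutely integrable on the line. [folklore] -/
private theorem integrable_lineKer {L₂ : ℝ} (hL : 0 < L₂) (t₀ z : ℝ) {y : ℝ} (hy : 0 < y) :
    Integrable fun v : ℝ => (y : ℂ) ^ ((z : ℂ) + s0 t₀ + v * I) * omega L₂ t₀ ((z : ℂ) + s0 t₀ + v * I) := by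
  refine ((integrable_profile hL z).const_mul (y ^ (z + 1 / 2))).mono'
    (continuous_lineKer L₂ t₀ z hy).aestronglyMeasurable (ae_of_all _ fun v => ?_)
  rw [norm_lineKer hL t₀ z hy]

/-- **The `ω`-kernel on the line through `𝔍(z)`**: `(1/2π)∫_ℝ y^{z+s₀+iv}ω(z+s₀+iv) dv
= y^{s₀}e^{−𝓛₂² log² y}` (`y > 0`; independent of `z`).
[cite: Zhang2022LandauSiegel, §15 p. 80 (`Z22:§15.u010`); §17 p. 96] -/
theorem integral_lineKer {L₂ : ℝ} (hL : 0 < L₂) (t₀ z : ℝ) {y : ℝ} (hy : 0 < y) :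
    (1 / (2 * π) : ℂ) * ∫ v : ℝ, (y : ℂ) ^ ((z : ℂ) + s0 t₀ + v * I) * omega L₂ t₀ ((z : ℂ) + s0 t₀ + v * I)
      = (y : ℂ) ^ (s0 t₀) * cexp (-(L₂ : ℂ) ^ 2 * (Real.log y : ℂ) ^ 2) := by
  have h : (fun v : ℝ => (y : ℂ) ^ ((z : ℂ) + s0 t₀ + v * I) * omega L₂ t₀ ((z : ℂ) + s0 t₀ + v * I))
      = fun v : ℝ => (fun t : ℝ => (y : ℂ) ^ (((z + 1 / 2 : ℝ) : ℂ) + t * I) *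
          omega L₂ t₀ (((z + 1 / 2 : ℝ) : ℂ) + t * I)) (2 * π * t₀ + v) := by
    funext v
    simp only [linePoint_eq, ofReal_add]
  rw [h, integral_add_left_eq_self (μ := volume)
    (fun t : ℝ => (y : ℂ) ^ (((z + 1 / 2 : ℝ) : ℂ) + t * I) * omega L₂ t₀ (((z + 1 / 2 : ℝ) : ℂ) + t * I))
    (2 * π * t₀), integral_cpow_mul_omega hL t₀ (z + 1 / 2) hy]

/-- Termwise algebra: `(a(m)m^{−s})(b(n)n^{s−1}) = a(m)b(n)n⁻¹·(n/m)^s` (`m, n ≥ 1`). [folklore] -/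
private theorem term_mul_eq (a b : ℕ → ℂ) (s : ℂ) {m n : ℕ} (hm : m ≠ 0) (hn : n ≠ 0) :
    LSeries.term a s m * (b n * (n : ℂ) ^ (s - 1))
      = a m * b n * (n : ℂ)⁻¹ * (((n : ℝ) / m : ℝ) : ℂ) ^ s := by
  have hm' : (0 : ℝ) < m := Nat.cast_pos.mpr (Nat.pos_of_ne_zero hm)
  have hn' : (0 : ℝ) < n := Nat.cast_pos.mpr (Nat.pos_of_ne_zero hn)
  have hmc : (m : ℂ) ^ s ≠ 0 := fun h => (Nat.cast_ne_zero.mpr hm) ((cpow_eq_zero_iff _ _).mp h).1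
  have hnc : (n : ℂ) ≠ 0 := Nat.cast_ne_zero.mpr hn
  rw [LSeries.term_of_ne_zero hm, GaussWeight.div_cpow_line hn' hm', Complex.ofReal_natCast,
    Complex.ofReal_natCast, Complex.cpow_sub _ _ hnc, Complex.cpow_one]
  field_simp

/-- **"Integrating term by term"** (`Z22:§17.u005` [Z22 p. 96, tex L4719–4727]: "replacing the
segment `𝔍(1)` by the line `σ = 3/2` and integrating term by term give `Φ₃⁺(p) = Σ_mΣ_n …
(n/m)^{s₀} … exp{−𝓛₂² log²(n/m)}`"; likewise `Z22:§15.u009–u010` [p. 80] and (17.8) [p. 98]): for a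
Dirichlet series `A(s) = Σ_m a(m)m^{−s}` absolutely convergent on the line `σ = z + 1/2`, a Dirichlet
polynomial `Σ_{n∈S} b(n)n^{s−1}` (`0 ∉ S`) and the weight `ω` (2.15),
`(1/2π)∫_ℝ A(s)·(Σ_n b(n)n^{s−1})·ω(s) dv = Σ_m Σ_n a(m)m^{−s₀}·b(n)n^{s₀−1}·exp{−𝓛₂² log²(n/m)}`,
`s = z + s₀ + iv` — i.e. `Σ_mΣ_n a(m)b(n)n⁻¹(n/m)^{s₀}exp{−𝓛₂² log²(n/m)}`. Absolute convergence
(`Σ_m ∫|·| < ∞`, Gaussian majorant of `|ω|`) justifies the interchange.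
[cite: Zhang2022LandauSiegel, §17 p. 96 (before (17.3)); §15 p. 80; §17 (17.8)] -/
theorem integral_LSeries_mul_sum_mul_omega {L₂ : ℝ} (hL : 0 < L₂) (t₀ z : ℝ) {a : ℕ → ℂ}
    (ha : LSeriesSummable a ((z + 1 / 2 : ℝ) : ℂ)) (b : ℕ → ℂ) {S : Finset ℕ} (hS : 0 ∉ S) :
    (1 / (2 * π) : ℂ) * ∫ v : ℝ,
        LSeries a ((z : ℂ) + s0 t₀ + v * I) *
          (∑ n ∈ S, b n * (n : ℂ) ^ (((z : ℂ) + s0 t₀ + v * I) - 1)) *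
          omega L₂ t₀ ((z : ℂ) + s0 t₀ + v * I)
      = ∑' m : ℕ, ∑ n ∈ S, LSeries.term a (s0 t₀) m * (b n * (n : ℂ) ^ (s0 t₀ - 1)) *
          cexp (-(L₂ : ℂ) ^ 2 * (Real.log ((n : ℝ) / m) : ℂ) ^ 2) := by
  have hπ : (π : ℂ) ≠ 0 := ofReal_ne_zero.mpr Real.pi_ne_zero
  set σ : ℝ := z + 1 / 2 with hσ
  -- the summands after distributing
  set g : ℕ → ℕ → ℝ → ℂ := fun m n v =>
    LSeries.term a ((z : ℂ) + s0 t₀ + v * I) m * (b n * (n : ℂ) ^ (((z : ℂ) + s0 t₀ + v * I) - 1)) *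
      omega L₂ t₀ ((z : ℂ) + s0 t₀ + v * I) with hg
  set f : ℕ → ℝ → ℂ := fun m v => ∑ n ∈ S, g m n v with hf
  -- termwise: `g m n = a(m)b(n)n⁻¹ · K_{n/m}`
  have hgK : ∀ m n v, m ≠ 0 → n ∈ S →
      g m n v = a m * b n * (n : ℂ)⁻¹ * ((((n : ℝ) / m : ℝ) : ℂ) ^ ((z : ℂ) + s0 t₀ + v * I) * omega L₂ t₀ ((z : ℂ) + s0 t₀ + v * I)) := by
    intro m n v hm hn
    have hn0 : n ≠ 0 := fun h => hS (h ▸ hn)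
    show LSeries.term a ((z : ℂ) + s0 t₀ + v * I) m *
        (b n * (n : ℂ) ^ (((z : ℂ) + s0 t₀ + v * I) - 1)) * omega L₂ t₀ ((z : ℂ) + s0 t₀ + v * I) = _
    rw [term_mul_eq a b _ hm hn0, mul_assoc]
  have hg0 : ∀ n v, g 0 n v = 0 := fun n v => by simp [hg, LSeries.term_zero]
  have hpos : ∀ {m n : ℕ}, m ≠ 0 → n ∈ S → (0 : ℝ) < (n : ℝ) / m := fun {m n} hm hn =>
    div_pos (Nat.cast_pos.mpr (Nat.pos_of_ne_zero fun h => hS (h ▸ hn)))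
      (Nat.cast_pos.mpr (Nat.pos_of_ne_zero hm))
  -- (1) the integrand is `Σ'_m f m`
  have hsum_eq : (fun v : ℝ => LSeries a ((z : ℂ) + s0 t₀ + v * I) *
        (∑ n ∈ S, b n * (n : ℂ) ^ (((z : ℂ) + s0 t₀ + v * I) - 1)) *
        omega L₂ t₀ ((z : ℂ) + s0 t₀ + v * I)) = fun v => ∑' m : ℕ, f m v := by
    funext v
    rw [LSeries, ← tsum_mul_right, ← tsum_mul_right]
    refine tsum_congr fun m => ?_
    simp only [hf, hg, Finset.mul_sum, Finset.sum_mul]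
  -- (2) each `f m` is integrable
  have hf_int : ∀ m, Integrable (f m) := by
    intro m
    rcases eq_or_ne m 0 with rfl | hm
    · simp only [hf, hg0, Finset.sum_const_zero]; exact integrable_zero _ _ _
    · refine integrable_finsetSum _ fun n hn => ?_
      have e : g m n = fun v : ℝ => a m * b n * (n : ℂ)⁻¹ * ((((n : ℝ) / m : ℝ) : ℂ) ^ ((z : ℂ) + s0 t₀ + v * I) * omega L₂ t₀ ((z : ℂ) + s0 t₀ + v * I)) :=
        funext fun v => hgK m n v hm hn
      rw [e]
      exact (integrable_lineKer hL t₀ z (hpos hm hn)).const_mul _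
  -- (3) `Σ_m ∫|f m| < ∞`
  set B : ℝ := ∑ n ∈ S, ‖b n‖ * (n : ℝ) ^ (σ - 1) with hB
  have hnorm_le : ∀ m v, ‖f m v‖ ≤ ‖LSeries.term a (σ : ℂ) m‖ * B *
      (Real.sqrt π / L₂ * Real.exp ((z ^ 2 - v ^ 2) / (4 * L₂ ^ 2))) := by
    intro m v
    rcases eq_or_ne m 0 with rfl | hm
    · simp [hf, hg0]
    · calc ‖f m v‖ ≤ ∑ n ∈ S, ‖g m n v‖ := norm_sum_le _ _
        _ = ∑ n ∈ S, ‖a m‖ * ‖b n‖ * (n : ℝ)⁻¹ * (((n : ℝ) / m) ^ σ *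
              (Real.sqrt π / L₂ * Real.exp ((z ^ 2 - v ^ 2) / (4 * L₂ ^ 2)))) := by
            refine Finset.sum_congr rfl fun n hn => ?_
            rw [hgK m n v hm hn, norm_mul, norm_mul, norm_mul, norm_inv, Complex.norm_natCast,
              norm_lineKer hL t₀ z (hpos hm hn)]
        _ = ‖LSeries.term a (σ : ℂ) m‖ * B *
              (Real.sqrt π / L₂ * Real.exp ((z ^ 2 - v ^ 2) / (4 * L₂ ^ 2))) := by
            rw [hB, Finset.mul_sum, Finset.sum_mul]
            refine Finset.sum_congr rfl fun n hn => ?_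
            have hn0 : n ≠ 0 := fun h => hS (h ▸ hn)
            have hn' : (0 : ℝ) < n := Nat.cast_pos.mpr (Nat.pos_of_ne_zero hn0)
            have hm' : (0 : ℝ) < m := Nat.cast_pos.mpr (Nat.pos_of_ne_zero hm)
            rw [LSeries.norm_term_eq, if_neg hm, ofReal_re, Real.div_rpow hn'.le hm'.le,
              Real.rpow_sub hn', Real.rpow_one]
            field_simp
  have hf_sum : Summable fun m : ℕ => ∫ v : ℝ, ‖f m v‖ := by
    have hmaj : Summable fun m : ℕ => ‖LSeries.term a (σ : ℂ) m‖ * B *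
        ∫ v : ℝ, Real.sqrt π / L₂ * Real.exp ((z ^ 2 - v ^ 2) / (4 * L₂ ^ 2)) := by
      refine (Summable.mul_right _ (Summable.mul_right _ ?_))
      exact summable_norm_iff.mpr ha
    refine Summable.of_nonneg_of_le (fun m => integral_nonneg fun v => norm_nonneg _)
      (fun m => ?_) hmaj
    calc ∫ v : ℝ, ‖f m v‖
        ≤ ∫ v : ℝ, ‖LSeries.term a (σ : ℂ) m‖ * B *
            (Real.sqrt π / L₂ * Real.exp ((z ^ 2 - v ^ 2) / (4 * L₂ ^ 2))) :=
          integral_mono (hf_int m).norm ((integrable_profile hL z).const_mul _) (hnorm_le m)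
      _ = ‖LSeries.term a (σ : ℂ) m‖ * B *
            ∫ v : ℝ, Real.sqrt π / L₂ * Real.exp ((z ^ 2 - v ^ 2) / (4 * L₂ ^ 2)) := by
          rw [integral_const_mul]
  -- (4) interchange and evaluate termwise
  rw [hsum_eq, ← integral_tsum_of_summable_integral_norm hf_int hf_sum, ← tsum_mul_left]
  refine tsum_congr fun m => ?_
  rcases eq_or_ne m 0 with rfl | hm
  · simp [hf, hg0, LSeries.term_zero]
  have e : ∀ n ∈ S, g m n = fun v : ℝ => a m * b n * (n : ℂ)⁻¹ * ((((n : ℝ) / m : ℝ) : ℂ) ^ ((z : ℂ) + s0 t₀ + v * I) * omega L₂ t₀ ((z : ℂ) + s0 t₀ + v * I)) :=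
    fun n hn => funext fun v => hgK m n v hm hn
  have hint : ∀ n ∈ S, Integrable (g m n) := fun n hn => by
    rw [e n hn]; exact (integrable_lineKer hL t₀ z (hpos hm hn)).const_mul _
  show (1 / (2 * π) : ℂ) * ∫ v : ℝ, ∑ n ∈ S, g m n v = _
  rw [integral_finsetSum _ hint, Finset.mul_sum]
  refine Finset.sum_congr rfl fun n hn => ?_
  have hn0 : n ≠ 0 := fun h => hS (h ▸ hn)
  rw [e n hn, integral_const_mul, ← mul_assoc, mul_comm (1 / (2 * π) : ℂ), mul_assoc,
    integral_lineKer hL t₀ z (hpos hm hn), ← mul_assoc, ← term_mul_eq a b _ hm hn0]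

end SmoothWeight

end Literature.NumberTheory.LFunctions.Zhang2022
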